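import Summits.Ventures.CertifiedManyBodySolver.Downfold.EmeryVanHoveFactorisation
import HarnessLib

/-!
# The van Hove filling of the ONE-BAND `t–t′` model is the universal `Ψ`: the saddle-point sublevel set of
# `ε₁(k) = c − 2t(cos kx + cos ky) − 4t′cos kx cos ky` is the bilinear region `{4 − 4(x + y) − 16q·xy ≥ 0}`,
# `q = −t′/(t + 2t′)`

Venture CertifiedManyBodySolver, cell `pub/hubbard-downfold` (stage S1 ↔ S2 dictionary D0), seat hubbard-downfold-mod-4 (technique B);
namespace `Summit.Ventures.CertifiedManyBodySolver.Downfold.Emery`. Everything PROVED (exact algebra + the measure-theoretic `bilinFrac` of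
`EmeryBilinearRegion`). WHAT THIS IS NOT: a statement about any material; a many-body statement (`U = 0` band kinematics); `t″ = 0` here
(the `t″` term is NOT bilinear in `(x, y)` — with `t″ ≠ 0` the saddle-point region is not of this form).

S2 (`pub/hubbard-fast`) words live on the one-band form `EmeryBlochBand.oneBand c t t′ t″` (dictionary D0). For `t″ = 0`:
* `oneBand_sub_saddle` — `ε₁(k) − ε₁(X) = −(t + 2t′)·bilin 4 1 q (x, y)` with `x = sin²(kx/2)`, `y = sin²(ky/2)`, `q = −t′/(t + 2t′)`
  (`t + 2t′ ≠ 0`; `ε₁(X) = c + 4t′` is the saddle-point energy at X = (π, 0));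
* `oneBand_le_saddle_iff` — in the cuprate regime `t + 2t′ > 0`: `ε₁(k) ≤ ε₁(X) ↔ 0 ≤ bilin 4 1 q (x, y)`;
* `oneBandVHSet_eq` — the occupied quadrant at the saddle energy IS `bilinRegion 4 1 q`, so its per-spin Brillouin-zone fraction is
  `Ψ(q) = vhFrac q` (`oneBandVHFilling_eq`) and the one-band van Hove hole doping is `1 − 2Ψ(q)` — the SAME universal function as the
  σ three-band model's (`EmeryVanHoveFactorisation.xVH_eq`, where `q = vhRatio`), tabulated once in `EmeryVanHoveTable{A–D}`
  (e.g. `t′/t = −0.2 ⇒ q = 1/3`; `t′/t = −0.3 ⇒ q = 3/4 ⇒ Ψ ∈ [0.3606, 0.3658]`, `x_VH ∈ [0.268, 0.279]`).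
* `q_of_ratio` — `q = ρ/(1 − 2ρ)` with `ρ = −t′/t` (`t ≠ 0`).

Sources: `t–t′` form and its saddle point at X [AndersenEtAl1995, §6]; [PavariniEtAl2001, Eq. (1)].
-/

noncomputable section

namespace Summit.Ventures.CertifiedManyBodySolver.Downfold.Emery

open Real MeasureTheory Set

/-- The one-band energy measured from the saddle point X = (π, 0) is a multiple of the universal bilinear form:
`ε₁(k) − (c + 4t′) = −(t + 2t′)·bilin 4 1 (−t′/(t + 2t′)) x y` with `x = sin²(kx/2)`, `y = sin²(ky/2)` (`t + 2t′ ≠ 0`).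
[cite: AndersenEtAl1995, §6] -/
theorem oneBand_sub_saddle {t t' : ℝ} (ht : t + 2 * t' ≠ 0) (c kx ky : ℝ) :
    oneBand c t t' 0 kx ky - (c + 4 * t') =
      -(t + 2 * t') * bilin 4 1 (-t' / (t + 2 * t')) (halfSq kx) (halfSq ky) := by
  rw [oneBand_eq_oneBandXY]
  unfold oneBandXY bilin halfSq
  field_simp
  ring

/-- The saddle-point value: `ε₁(π, 0) = c + 4t′`. [folklore] -/
theorem oneBand_at_X (c t t' : ℝ) : oneBand c t t' 0 π 0 = c + 4 * t' := by
  unfold oneBand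
  simp [Real.cos_pi, Real.cos_zero]

/-- **In the cuprate regime `t + 2t′ > 0`: `ε₁(k) ≤ ε₁(X) ↔ 0 ≤ bilin 4 1 q (x, y)`, `q = −t′/(t + 2t′)`.** [folklore] -/
theorem oneBand_le_saddle_iff {t t' : ℝ} (ht : 0 < t + 2 * t') (c kx ky : ℝ) :
    oneBand c t t' 0 kx ky ≤ c + 4 * t' ↔ 0 ≤ bilin 4 1 (-t' / (t + 2 * t')) (halfSq kx) (halfSq ky) := by
  have h := oneBand_sub_saddle ht.ne' c kx ky
  constructor
  · intro hle
    have h1 : (t + 2 * t') * bilin 4 1 (-t' / (t + 2 * t')) (halfSq kx) (halfSq ky) ≥ 0 := by linarith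
    exact nonneg_of_mul_nonneg_right (by linarith) ht
  · intro hb
    have : 0 ≤ (t + 2 * t') * bilin 4 1 (-t' / (t + 2 * t')) (halfSq kx) (halfSq ky) := mul_nonneg ht.le hb
    linarith

/-- The OCCUPIED QUADRANT of the one-band `t–t′` model at its saddle-point energy. [cite: AndersenEtAl1995, §6] -/
def oneBandVHSet (c t t' : ℝ) : Set (ℝ × ℝ) :=
  {k | k ∈ Icc (0 : ℝ) π ×ˢ Icc (0 : ℝ) π ∧ oneBand c t t' 0 k.1 k.2 ≤ c + 4 * t'}

/-- **THE ONE-BAND VAN HOVE SET IS THE UNIVERSAL BILINEAR REGION** (`t + 2t′ > 0`). [folklore] -/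
theorem oneBandVHSet_eq {t t' : ℝ} (ht : 0 < t + 2 * t') (c : ℝ) :
    oneBandVHSet c t t' = bilinRegion 4 1 (-t' / (t + 2 * t')) := by
  ext k
  simp only [oneBandVHSet, bilinRegion, Set.mem_setOf_eq, oneBand_le_saddle_iff ht]

/-- The per-spin VAN HOVE FILLING of the one-band `t–t′` model (BZ fraction below the saddle energy). [folklore] -/
def oneBandVHFilling (c t t' : ℝ) : ℝ := (volume (oneBandVHSet c t t')).toReal / π ^ 2

/-- **`n_VH/2 = Ψ(q)`**: the one-band van Hove filling is the universal `vhFrac` at `q = −t′/(t + 2t′)`; hence the one-band van Hove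
hole doping (relative to half filling) is `1 − 2Ψ(q)` — read off `EmeryVanHoveTable{A–D}`. [folklore] -/
theorem oneBandVHFilling_eq {t t' : ℝ} (ht : 0 < t + 2 * t') (c : ℝ) :
    oneBandVHFilling c t t' = vhFrac (-t' / (t + 2 * t')) := by
  unfold oneBandVHFilling vhFrac bilinFrac
  rw [oneBandVHSet_eq ht]

/-- The table variable from the hopping ratio: `−t′/(t + 2t′) = ρ/(1 − 2ρ)` with `ρ = −t′/t` (`t ≠ 0`). [folklore] -/
theorem q_of_ratio {t t' : ℝ} (ht0 : t ≠ 0) :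
    -t' / (t + 2 * t') = (-t' / t) / (1 - 2 * (-t' / t)) := by
  have h1 : 1 - 2 * (-t' / t) = (t + 2 * t') / t := by field_simp; ring
  rw [h1, div_div_div_cancel_right₀ ht0]

/-- Monotonicity for consumers: a more negative `t′/t` (larger `q`) LOWERS the van Hove filling, i.e. pushes the van Hove hole doping up
(`vhFrac_anti`). Example bracket from the table: `t′/t ∈ [−0.3, −0.2]` ⇒ `q ∈ [1/3, 3/4]`. [folklore] -/
theorem oneBandVHFilling_anti {t₁ t₁' t₂ t₂' : ℝ} (h₁ : 0 < t₁ + 2 * t₁') (h₂ : 0 < t₂ + 2 * t₂')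
    (hq : -t₁' / (t₁ + 2 * t₁') ≤ -t₂' / (t₂ + 2 * t₂')) (c₁ c₂ : ℝ) :
    oneBandVHFilling c₂ t₂ t₂' ≤ oneBandVHFilling c₁ t₁ t₁' := by
  rw [oneBandVHFilling_eq h₁, oneBandVHFilling_eq h₂]
  exact vhFrac_anti hq

end Summit.Ventures.CertifiedManyBodySolver.Downfold.Emery
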